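import Literature.Probability.RandomPlanarGeometry.SLEKappaRhoDriving
import Literature.Probability.RandomPlanarGeometry.SimplePathConfig
import Literature.Probability.RandomPlanarGeometry.LoewnerHullUnion
import Literature.Probability.RandomPlanarGeometry.SLETransienceLocal
import Literature.Probability.RandomPlanarGeometry.CritPercSLESimplePathProofs
import Literature.Probability.RandomPlanarGeometry.CritPercSLESwallowingProofs
import Literature.Probability.RandomPlanarGeometry.CritPercSLELocalityMartingaleProofs
import Literature.Probability.RandomPlanarGeometry.SLERestrictionLemmas
import Literature.Probability.RandomPlanarGeometry.LoewnerMapProofs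
import Literature.Probability.RandomPlanarGeometry.LocalMartingaleProofs
import Literature.Probability.RandomPlanarGeometry.SLETraceContinuity
import HarnessLib

/-!
# "Which is `1/2` by symmetry" ([LSW] proof of Cor. 8.6, p. 38): the symmetry argument, proved

Proofs for the named fact
`Literature.Probability.RandomPlanarGeometry.measure_I_notMem_leftFilling_sle_eq_half`
(`SLEKappaRhoDriving`), after

* G. F. Lawler, O. Schramm, W. Werner, *Conformal restriction: the chordal case*, J. Amer. Math.
  Soc. **16** (2003) 917–955, arXiv:math/0209343 (**[LSW]**), proof of Cor. 8.6 (p. 38): "the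
  probability that `i` ends up eventually to 'the right' of the right hand boundary of
  SLE(8/3, ρ) […] is strictly larger than the corresponding quantity for SLE(8/3, 0), which is
  `1/2` by symmetry";
* S. Rohde, O. Schramm, *Basic properties of SLE*, Ann. of Math. **161** (2005) 883–924
  (**[RS05]**), Thm. 5.1 (the trace), Thm. 6.1 (simple for `κ ≤ 4`), Thm. 7.1 (transient),
  Thm. 6.4 / Lemma 6.3 (a fixed point of `ℍ` is a.s. off the trace, `κ < 8`).

We PROVE the symmetry sentence for chordal SLE_κ, `0 < κ < 4`, **given only that SLE_κ is
generated by a curve** (`HasSLETrace κ`, [RS05] Thm. 5.1, the tree's named fact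
`hasSLETrace_of_ne_eight`, in the tree reduced to [RS05] Cor. 3.5 `RohdeSchramm2005_cor35`):

* `Literature.Probability.RandomPlanarGeometry.measure_setOf_I_notMem_leftFilling_eq_half_of_hasSLETrace` —
  for `0 < κ < 4` with `HasSLETrace κ`: `P{i ∉ F^{ℝ₊}_ℍ(cl K_∞(√κ B))} = 1/2`;
* `Literature.Probability.RandomPlanarGeometry.measure_I_notMem_leftFilling_sle_eq_half_of_hasSLETrace` —
  the named fact `measure_I_notMem_leftFilling_sle_eq_half` (κ = 8/3) from `HasSLETrace (8/3)`,
  hence (`…_of_RS05`) from `hasSLETrace_of_ne_eight`, hence (`…_of_cor35`) from the single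
  remaining stochastic leaf of the tree's reduction of [RS05] Thm. 5.1, the one-point derivative
  estimate `RohdeSchramm2005_cor35` ([RS05] Cor. 3.5; `hasSLETrace_of_ne_eight_of_cor35`).

The printed "by symmetry" unfolds into three ingredients, all theorems of the tree:

1. **almost sure geometry** — a.s. the SLE_κ trace `γ` is a simple path from `0` to `∞` in `ℍ`
   (`ae_isSimpleTrace_sleTrace_of_hasSLETrace`, `tendsto_norm_sleTrace_atTop_of_hasSLETrace_of_lt_four`,
   i.e. an `IsChordalSimplePath`, `SimplePathConfig`) not passing through `i`
   (`ae_notMem_range_sleTrace_of_lt_eight`); then `K_∞ = γ(0, ∞)` (`hull_eq_image`), so that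
   `cl K_∞` is the closure of the configuration `γ(0, ∞) ∈ Ω` ([LSW] Def. 3.1), `F^{ℝ₊}_ℍ(cl K_∞)`
   is its left fill, "`i ∉ F^{ℝ₊}_ℍ(cl K_∞)`" is "`i` lies in the right domain" and **exactly one**
   of "`i` right of `γ`", "`i` left of `γ`" holds (`mem_rightDomain_or_mem_leftDomain`,
   `disjoint_rightDomain_leftDomain`);
2. **reflection** — the chain of `−W` is generated by the mirror image `σ ∘ γ`, `σ(z) = −z̄`
   (`IsGeneratedByCurve.neg_conj`), whose configuration is `σ(γ(0, ∞))` (`toConfig_negConj`), and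
   `i` is right of `σK` iff `i = σ(i)` is left of `K` (`mem_rightDomain_reflect_iff`); the law of
   `√κ B` on path space is `σ`-invariant (`identDistrib_sleDriving_neg`);
3. **measurability** — "`i` is right of `K`" is detected by countably many avoidance events
   `{cl K_∞ ∩ A = ∅}`, `A` the half-plane fill of a finite union of dyadic squares through `i`
   which is a `+`-hull (`RightConfig.exists_dyadicUnion_isPlusHull_hpFill`,
   `RestrictionConfig.disjoint_leftFill_iff`), and these avoidance events are measurable
   functions of the driving path (`Loewner.measurableSet_setOf_disjoint_closure_hullUnion`),
   so the identity in law applies (through the measurable continuous version of the coordinate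
   path, `exists_measurable_continuous_version`).

Hence `P(right) = P(left)`, `P(right ∧ left) = 0`, `P(right ∨ left) = 1`, so `P(right) = 1/2`.

No new named facts. What is NOT here: `HasSLETrace (8/3)` itself ([RS05] Thm. 5.1 / Cor. 3.5),
which keeps `measure_I_notMem_leftFilling_sle_eq_half_holds` out of reach for now.
-/

noncomputable section

open Set Filter MeasureTheory ProbabilityTheory Complex
open UpperHalfPlane (upperHalfPlaneSet)
open scoped NNReal ENNReal ComplexConjugate
open Literature.Probability.Process (preWienerMeasure)

namespace Literature.Probability.RandomPlanarGeometry

/-! ### Detecting "`z` is to the right of `K`" by avoidance of `+`-hulls -/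

/-- **"`z` is to the right of `K ∈ Ω`" is a countable union of avoidance conditions**: for
`z ∈ ℍ`, `z ∈ rightDomain K` iff some half-plane fill `A` of a finite union of dyadic squares
containing `z` is a `+`-hull with `cl K ∩ A = ∅` (then `A ⊆ rightDomain K`; conversely such an
`A` exists by `RightConfig.exists_dyadicUnion_isPlusHull_hpFill` applied to `F^{ℝ₊}_ℍ(K) ∈ Ω₊`).
[cite: LawlerSchrammWerner2003Restriction, §8.1 p. 31 with proof of Cor. 8.6 (p. 38)] -/
theorem RestrictionConfig.mem_rightDomain_iff_exists_dyadicUnion (K : RestrictionConfig) {z : ℂ}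
    (hz : 0 < z.im) :
    z ∈ K.rightDomain ↔ ∃ (n : ℕ) (F : Finset (ℤ × ℤ)), z ∈ dyadicUnion n F ∧
      IsPlusHull (hpFill (dyadicUnion n F)) ∧
        Disjoint (closure (K : Set ℂ)) (hpFill (dyadicUnion n F)) := by
  constructor
  · intro h
    have hzK : z ∉ ((K.leftFillConfig : RightConfig) : Set ℂ) := by
      rw [RestrictionConfig.coe_leftFillConfig]
      exact (K.notMem_leftFill_iff hz).2 h
    obtain ⟨n, F, hzS, hplus, hdisj⟩ :=
      K.leftFillConfig.exists_dyadicUnion_isPlusHull_hpFill (by exact hz) hzK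
    refine ⟨n, F, hzS, hplus, ?_⟩
    rw [RestrictionConfig.coe_leftFillConfig] at hdisj
    exact hdisj.mono_left K.closure_subset_leftFill
  · rintro ⟨n, F, hzS, hplus, hdisj⟩
    have h1 : Disjoint K.leftFill (hpFill (dyadicUnion n F)) :=
      (K.disjoint_leftFill_iff hplus).2 (hdisj.mono_left subset_closure)
    have hzA : z ∈ hpFill (dyadicUnion n F) := inter_subset_hpFill _ ⟨hzS, hz⟩
    exact (K.notMem_leftFill_iff hz).1 fun hzL ↦ Set.disjoint_left.1 h1 hzL hzA

/-- **The detection events are measurable** along any measurably parametrised family of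
continuous driving functions: the set of `ω` such that `cl K_∞(Φ ω)` avoids some `+`-hull which
is the half-plane fill of a finite union of dyadic squares containing `z` is a countable union
of avoidance events `{cl K_∞ ∩ A = ∅}`, `A` compact, each measurable by
`Loewner.measurableSet_setOf_disjoint_closure_hullUnion`.
[cite: LawlerSchrammWerner2003Restriction, Thm. 8.4 (p. 37) with §8.1 (p. 31)] -/
theorem measurableSet_setOf_exists_disjoint_closure_hullUnion {Ω : Type*} [MeasurableSpace Ω]
    {Φ : Ω → C(ℝ≥0, ℝ)} (hΦ : ∀ s, Measurable fun ω ↦ Φ ω s) (z : ℂ) :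
    MeasurableSet {ω | ∃ (n : ℕ) (F : Finset (ℤ × ℤ)), z ∈ dyadicUnion n F ∧
      IsPlusHull (hpFill (dyadicUnion n F)) ∧
        Disjoint (closure (Loewner.hullUnion (Φ ω))) (hpFill (dyadicUnion n F))} := by
  have hrep : {ω | ∃ (n : ℕ) (F : Finset (ℤ × ℤ)), z ∈ dyadicUnion n F ∧
      IsPlusHull (hpFill (dyadicUnion n F)) ∧
        Disjoint (closure (Loewner.hullUnion (Φ ω))) (hpFill (dyadicUnion n F))} =
      ⋃ (n : ℕ) (F : Finset (ℤ × ℤ))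
        (_ : z ∈ dyadicUnion n F ∧ IsPlusHull (hpFill (dyadicUnion n F))),
        {ω | Disjoint (closure (Loewner.hullUnion (Φ ω))) (hpFill (dyadicUnion n F))} := by
    ext ω
    simp only [mem_setOf_eq, mem_iUnion, exists_prop, and_assoc]
  rw [hrep]
  exact MeasurableSet.iUnion fun n ↦ MeasurableSet.iUnion fun F ↦ MeasurableSet.iUnion fun h ↦
    Loewner.measurableSet_setOf_disjoint_closure_hullUnion hΦ h.2.1.isBoundedHull.isCompact

/-! ### Deterministic geometry of a chain generated by a simple path from `0` to `∞` -/

namespace IsChordalSimplePath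

variable {W : ℝ≥0 → ℝ} {γ : ℝ≥0 → ℂ}

/-- **`K_∞ = γ(0, ∞)`** for a Loewner chain generated by a simple path from `0` to `∞` in `ℍ`
(`K_t = γ(0, t]`, `Loewner.IsGeneratedByCurve.hull_eq_image`): the union of the hulls is the
configuration `γ(0, ∞) ∈ Ω` of the path. [cite: LawlerSchrammWerner2003Restriction, Def. 3.1 (p. 10)] -/
theorem hullUnion_eq (hγ : IsChordalSimplePath γ) (hgen : Loewner.IsGeneratedByCurve W γ) :
    Loewner.hullUnion W = ((hγ.toConfig : RestrictionConfig) : Set ℂ) := by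
  rw [coe_toConfig]
  ext z
  simp only [Loewner.hullUnion, mem_iUnion, hgen.hull_eq_image hγ.isSimpleTrace, mem_image,
    mem_Ioc, mem_Ioi]
  constructor
  · rintro ⟨t, s, ⟨hs0, -⟩, rfl⟩
    exact ⟨s, hs0, rfl⟩
  · rintro ⟨s, hs0, rfl⟩
    exact ⟨s, s, ⟨hs0, le_rfl⟩, rfl⟩

/-- **"`z ∉ F^{ℝ₊}_ℍ(cl K_∞)`" is "`z` is to the right of the path"**: for a chain generated by
a simple path `γ` from `0` to `∞` in `ℍ` and `z ∈ ℍ`, `z ∉ leftFilling (cl K_∞)` iff `z` lies in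
the right domain of the configuration `γ(0, ∞)` (`leftFilling_closure_eq_leftFill`).
[cite: LawlerSchrammWerner2003Restriction, proof of Cor. 8.6 (p. 38) with §2 p. 8 (F^{ℝ₊}_ℍ)] -/
theorem notMem_leftFilling_iff (hγ : IsChordalSimplePath γ) (hgen : Loewner.IsGeneratedByCurve W γ)
    {z : ℂ} (hz : 0 < z.im) :
    z ∉ leftFilling (closure (Loewner.hullUnion W)) ↔ z ∈ hγ.toConfig.rightDomain := by
  rw [hγ.hullUnion_eq hgen, leftFilling_closure_eq_leftFill,
    RestrictionConfig.notMem_leftFill_iff _ hz]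

/-- **The detection events detect "`z` is to the right of the path"** (for chains generated
by a simple path from `0` to `∞` in `ℍ`): `cl K_∞(W)` avoids some `+`-hull filled from dyadic
squares through `z` iff `z` lies in the right domain of `γ(0, ∞)`. [folklore] -/
theorem exists_disjoint_iff (hγ : IsChordalSimplePath γ) (hgen : Loewner.IsGeneratedByCurve W γ)
    {z : ℂ} (hz : 0 < z.im) :
    (∃ (n : ℕ) (F : Finset (ℤ × ℤ)), z ∈ dyadicUnion n F ∧ IsPlusHull (hpFill (dyadicUnion n F)) ∧
      Disjoint (closure (Loewner.hullUnion W)) (hpFill (dyadicUnion n F))) ↔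
      z ∈ hγ.toConfig.rightDomain := by
  rw [hγ.toConfig.mem_rightDomain_iff_exists_dyadicUnion hz, hγ.hullUnion_eq hgen]

/-- `i` is off the mirror image `σ ∘ γ` of a path missing `i` (`σ(i) = i`). [folklore] -/
theorem I_notMem_range_negConj (hI : I ∉ range γ) : I ∉ range fun t ↦ -conj (γ t) := by
  rintro ⟨t, ht⟩
  refine hI ⟨t, ?_⟩
  have h := congrArg (fun z : ℂ ↦ -conj z) ht
  simpa using h

/-- **Reflection**: for the chain of `−W`, generated by the mirror image `σ ∘ γ`
(`IsGeneratedByCurve.neg_conj`) whose configuration is `σK` (`toConfig_negConj`),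
"`i ∉ F^{ℝ₊}_ℍ(cl K_∞(−W))`" is "`i` is to the LEFT of `γ`" (`mem_rightDomain_reflect_iff`,
`σ(i) = i`). [cite: LawlerSchrammWerner2003Restriction, proof of Cor. 8.6 (p. 38), "by symmetry"] -/
theorem notMem_leftFilling_neg_iff (hγ : IsChordalSimplePath γ)
    (hgen : Loewner.IsGeneratedByCurve W γ) :
    I ∉ leftFilling (closure (Loewner.hullUnion fun t ↦ -W t)) ↔ I ∈ hγ.toConfig.leftDomain := by
  rw [hγ.negConj.notMem_leftFilling_iff hgen.neg_conj (show 0 < I.im by simp), hγ.toConfig_negConj,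
    RestrictionConfig.mem_rightDomain_reflect_iff, show imagAxisRefl I = I by simp]

/-- **Reflection, detection form**: `cl K_∞(−W)` avoids some `+`-hull filled from dyadic
squares through `i` iff `i` is to the left of `γ`. [folklore] -/
theorem exists_disjoint_neg_iff (hγ : IsChordalSimplePath γ)
    (hgen : Loewner.IsGeneratedByCurve W γ) :
    (∃ (n : ℕ) (F : Finset (ℤ × ℤ)), I ∈ dyadicUnion n F ∧ IsPlusHull (hpFill (dyadicUnion n F)) ∧
      Disjoint (closure (Loewner.hullUnion fun t ↦ -W t)) (hpFill (dyadicUnion n F))) ↔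
      I ∈ hγ.toConfig.leftDomain := by
  rw [hγ.negConj.exists_disjoint_iff hgen.neg_conj (show 0 < I.im by simp), hγ.toConfig_negConj,
    RestrictionConfig.mem_rightDomain_reflect_iff, show imagAxisRefl I = I by simp]

end IsChordalSimplePath

/-! ### The symmetry sentence for SLE_κ, `0 < κ < 4`, given the trace -/

/-- **`P{i ∉ F^{ℝ₊}_ℍ(cl K_∞)} = 1/2` for chordal SLE_κ, `0 < κ < 4`, given that SLE_κ is
generated by a curve** ([LSW] proof of Cor. 8.6, p. 38: "the corresponding quantity for
SLE(8/3, 0), which is `1/2` by symmetry"). Proof: a.s. the trace is a simple path from `0` to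
`∞` in `ℍ` missing `i` ([RS05] Thms. 6.1, 7.1, 6.4), so exactly one of "`i` right of `γ`",
"`i` left of `γ`" holds; the second is the first for the reflected driving function `−√κ B`,
which has the same law (`identDistrib_sleDriving_neg`), and both are detected by measurable
avoidance events of the driving path; so both have probability `1/2`.
[cite: LawlerSchrammWerner2003Restriction, proof of Cor. 8.6 (p. 38), second sentence ("which is 1/2 by symmetry")] -/
theorem measure_setOf_I_notMem_leftFilling_eq_half_of_hasSLETrace {κ : ℝ≥0} (h0 : 0 < κ)
    (h4 : κ < 4) (hT : HasSLETrace κ) :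
    preWienerMeasure {ω | I ∉ leftFilling (closure (Loewner.hullUnion (sleDriving κ ω)))} = 1 / 2 := by
  haveI : IsProbabilityMeasure preWienerMeasure := isProbabilityMeasure_preWienerMeasure'
  have hIim : 0 < I.im := by simp
  -- (1) the almost sure geometry
  have hgood : ∀ᵐ ω ∂preWienerMeasure, ∃ hγ : IsChordalSimplePath (sleTrace κ ω),
      Loewner.IsGeneratedByCurve (sleDriving κ ω) (sleTrace κ ω) ∧
        I ∉ ((hγ.toConfig : RestrictionConfig) : Set ℂ) := by
    filter_upwards [ae_isGeneratedByCurve_sleTrace hT, ae_isSimpleTrace_sleTrace_of_hasSLETrace hT h4.le,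
      tendsto_norm_sleTrace_atTop_of_hasSLETrace_of_lt_four h0 h4 hT,
      ae_notMem_range_sleTrace_of_lt_eight h0 (h4.trans (by norm_num)) hIim] with ω hgen hs htr hI
    have hγ : IsChordalSimplePath (sleTrace κ ω) :=
      ⟨hgen.continuous, hs, by rw [hgen.apply_zero, sleDriving_zero, Complex.ofReal_zero], htr⟩
    exact ⟨hγ, hgen, hγ.notMem_toConfig_of_notMem_range hI⟩
  -- (3) the measurable detection events, through the continuous version of the coordinate path
  obtain ⟨C, hCm, hCc, -, hCid⟩ := exists_measurable_continuous_version
  set S : Set (ℝ≥0 → ℝ) := {U | ∃ (n : ℕ) (F : Finset (ℤ × ℤ)), I ∈ dyadicUnion n F ∧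
    IsPlusHull (hpFill (dyadicUnion n F)) ∧
      Disjoint (closure (Loewner.hullUnion ((⟨C U, hCc U⟩ : C(ℝ≥0, ℝ)))))
        (hpFill (dyadicUnion n F))} with hS_def
  have hS : MeasurableSet S :=
    measurableSet_setOf_exists_disjoint_closure_hullUnion
      (Φ := fun U ↦ (⟨C U, hCc U⟩ : C(ℝ≥0, ℝ))) (fun s ↦ (measurable_pi_apply s).comp hCm) I
  set A : Set (ℝ≥0 → ℝ) := (fun ω t ↦ sleDriving κ ω t) ⁻¹' S with hA_def
  set A' : Set (ℝ≥0 → ℝ) := (fun ω t ↦ -sleDriving κ ω t) ⁻¹' S with hA'_def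
  have hA : ∀ ω, ω ∈ A ↔ ∃ (n : ℕ) (F : Finset (ℤ × ℤ)), I ∈ dyadicUnion n F ∧
      IsPlusHull (hpFill (dyadicUnion n F)) ∧
        Disjoint (closure (Loewner.hullUnion (sleDriving κ ω))) (hpFill (dyadicUnion n F)) :=
    fun ω ↦ by
    simp only [hA_def, hS_def, mem_preimage, mem_setOf_eq, ContinuousMap.coe_mk]
    rw [hCid _ (continuous_sleDriving κ ω) (sleDriving_zero κ ω)]
  have hA' : ∀ ω, ω ∈ A' ↔ ∃ (n : ℕ) (F : Finset (ℤ × ℤ)), I ∈ dyadicUnion n F ∧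
      IsPlusHull (hpFill (dyadicUnion n F)) ∧
        Disjoint (closure (Loewner.hullUnion fun t ↦ -sleDriving κ ω t))
          (hpFill (dyadicUnion n F)) := fun ω ↦ by
    simp only [hA'_def, hS_def, mem_preimage, mem_setOf_eq, ContinuousMap.coe_mk]
    rw [hCid (fun t ↦ -sleDriving κ ω t) (continuous_sleDriving κ ω).neg (by simp)]
  have hA'm : MeasurableSet A' :=
    (measurable_pi_lambda _ fun t ↦ (measurable_sleDriving κ t).neg) hS
  -- (2) reflection: the two detection events have the same probability
  have hPA : preWienerMeasure A = preWienerMeasure A' :=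
    (identDistrib_sleDriving_neg κ).measure_mem_eq hS
  -- the target event is a.e. the detection event; the two detection events a.e. partition
  have hEA : {ω | I ∉ leftFilling (closure (Loewner.hullUnion (sleDriving κ ω)))}
      =ᵐ[preWienerMeasure] A := by
    filter_upwards [hgood] with ω ⟨hγ, hgen, _⟩
    exact propext ((hγ.notMem_leftFilling_iff hgen hIim).trans ((hA ω).trans
      (hγ.exists_disjoint_iff hgen hIim)).symm)
  have hunion : preWienerMeasure (A ∪ A') = 1 := by
    rw [measure_congr (Filter.eventuallyEq_univ.2 ?_), measure_univ]
    filter_upwards [hgood] with ω ⟨hγ, hgen, hIK⟩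
    rcases hγ.toConfig.mem_rightDomain_or_mem_leftDomain hIim hIK with h | h
    · exact Or.inl ((hA ω).2 ((hγ.exists_disjoint_iff hgen hIim).2 h))
    · exact Or.inr ((hA' ω).2 ((hγ.exists_disjoint_neg_iff hgen).2 h))
  have hinter : preWienerMeasure (A ∩ A') = 0 := by
    rw [measure_eq_zero_iff_ae_notMem]
    filter_upwards [hgood] with ω ⟨hγ, hgen, _⟩
    rintro ⟨ha, ha'⟩
    exact Set.disjoint_left.1 hγ.toConfig.disjoint_rightDomain_leftDomain
      ((hγ.exists_disjoint_iff hgen hIim).1 ((hA ω).1 ha))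
      ((hγ.exists_disjoint_neg_iff hgen).1 ((hA' ω).1 ha'))
  have hsum : 2 * preWienerMeasure A = 1 := by
    have h := measure_union_add_inter A hA'm (μ := preWienerMeasure)
    rw [hunion, hinter, add_zero, ← hPA, ← two_mul] at h
    exact h.symm
  rw [measure_congr hEA, ENNReal.eq_div_iff two_ne_zero ENNReal.ofNat_ne_top]
  exact hsum

/-- **The symmetry sentence for SLE_{8/3} from the existence of its trace**: the named fact
`measure_I_notMem_leftFilling_sle_eq_half` ([LSW] p. 38, "which is `1/2` by symmetry") follows
from `HasSLETrace (8/3)` ([RS05] Thm. 5.1 at `κ = 8/3`).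
[cite: LawlerSchrammWerner2003Restriction, proof of Cor. 8.6 (p. 38), second sentence ("which is 1/2 by symmetry")] -/
theorem measure_I_notMem_leftFilling_sle_eq_half_of_hasSLETrace
    (hT : HasSLETrace ((8 : ℝ≥0) / 3)) : measure_I_notMem_leftFilling_sle_eq_half := by
  refine measure_setOf_I_notMem_leftFilling_eq_half_of_hasSLETrace (by positivity) ?_ hT
  rw [div_lt_iff₀ (by norm_num : (0 : ℝ≥0) < 3)]
  norm_num

/-- **The symmetry sentence for SLE_{8/3} from the Rohde–Schramm trace theorem** (the named
fact `hasSLETrace_of_ne_eight`, [RS05] Thm. 5.1; `8/3 ≠ 8`).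
[cite: LawlerSchrammWerner2003Restriction, proof of Cor. 8.6 (p. 38), second sentence ("which is 1/2 by symmetry")] -/
theorem measure_I_notMem_leftFilling_sle_eq_half_of_RS05 (h51 : hasSLETrace_of_ne_eight) :
    measure_I_notMem_leftFilling_sle_eq_half :=
  measure_I_notMem_leftFilling_sle_eq_half_of_hasSLETrace (h51 (by norm_num))

/-- **The symmetry sentence for SLE_{8/3} from Rohde–Schramm's one-point derivative estimate**
([RS05] Cor. 3.5 on the canonical space, the named fact `RohdeSchramm2005_cor35`, to which the
tree reduces Thm. 5.1 for `κ ≠ 8`: `hasSLETrace_of_ne_eight_of_cor35`). This is the shape of the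
eventual discharge `measure_I_notMem_leftFilling_sle_eq_half_holds`.
[cite: LawlerSchrammWerner2003Restriction, proof of Cor. 8.6 (p. 38), second sentence ("which is 1/2 by symmetry")] -/
theorem measure_I_notMem_leftFilling_sle_eq_half_of_cor35
    (h35 : RohdeSchramm2005_cor35 preWienerMeasure) : measure_I_notMem_leftFilling_sle_eq_half :=
  measure_I_notMem_leftFilling_sle_eq_half_of_RS05 (hasSLETrace_of_ne_eight_of_cor35 h35)

end Literature.Probability.RandomPlanarGeometry

end
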